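import Literature.RepresentationTheory.HeisenbergGroup.SymplecticPiBigCell
import Literature.RepresentationTheory.HeisenbergGroup.ImplementerCocycleClass
import HarnessLib

/-!
# The Schrödinger big-cell section `r(g) = r(n(DB⁻¹)) r(m(B)) r(w) r(n(B⁻¹A))` on `𝒮(F^ι)` and Weil's formula
# `r(g₁) r(g₂) = κ(T) r(g₁g₂)` on the big cell

Topic `RepresentationTheory/HeisenbergGroup`; namespace `Literature.RepresentationTheory.HeisenbergGroup`. KERNEL
mathematics only (definitions with bodies + theorems; no named fact, no `axiom`, no `sorry`).

`F` is a non-archimedean local field with `2` invertible, `ψ` a non-trivial continuous character with conductor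
exponent `m`, `μ` a Haar measure on `F` (self-dual where stated), `X = Y = F^ι`, and `r(n(c)) = unipOpPi`,
`r(m(a)) = leviOpPi` (normalised by `|det a|^{-1/2}`), `r(w) = fourierOpPi` are the standard operators of
`SchrodingerPiOperators.lean` on `𝒮(F^ι)`; `κ(S) = g(-q_S)|det S|^{1/2}` is Weil's constant of
`SchrodingerPiWeilIdentity.lean` (`weilKappa`).

* §1 **`|κ(S)| = 1` and `κ(S) = γ(-q_S)` for the SELF-DUAL measure** (`norm_weilKappa`, `weilKappa_eq_weilIndexQF`):
  Weil's identity for `S` and for `-S`, together with `r(w)² = r(m(-1))` and `r(w) r(m(a)) = r(m(ᵗa⁻¹)) r(w)`, gives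
  `κ(S) κ(-S) = 1`, while `κ(-S) = conj κ(S)` ([Weil1964] n° 14 Thm 2 Cor. 2: `|γ(f)| = 1` for the self-dual
  measure; [Rangarao1993] (4.1): "`c(σ₁, σ₂)` is a complex number of absolute value one").
* §2 **the big-cell section** `bigCellOp g := r(n(DB⁻¹)) r(m(B)) r(w) r(n(B⁻¹A))` for `g = (A B; C D)` with `B`
  invertible (and `1` off the cell) — Weil's `r(s)` on `Ω`, [Weil1964] n° 13 (29); [Rangarao1993] (3.12) with
  `S = {1, …, n}` —; its value on canonical words (`bigCellOp_canonicalWord`) and `(g, bigCellOp g) ∈ S̃p_ψ`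
  (`bigCellOp_mem_MpPsi`).
* §3 **Weil's multiplication formula on the big cell** ([Weil1964] n° 15 Thm 3: "`r(s) r(s') = γ(f₀) r(s'')`";
  [Rangarao1993] Thm 4.1 (4) and p. 336): for canonical words `gᵢ = n(γᵢ) m(Bᵢ) w n(δᵢ)` with
  `T = ᵗB₂ (δ₁ + γ₂) B₂` invertible (i.e. `g₁g₂ ∈ Ω`), `g₁ g₂ = n(γ₁ + M) m(B₁ ᵗB₂⁻¹ T) w n(δ₂ - T⁻¹)`
  (`canonicalWord_mul_canonicalWord`) and `bigCellOp(g₁) bigCellOp(g₂) = κ(T) · bigCellOp(g₁ g₂)`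
  (`bigCellOp_mul_bigCellOp`).

## References

* [Weil1964] A. Weil, Acta Math. 111 (1964): n° 13 (29) p. 160, n° 14 Thm 2 and Cor. 2 pp. 161–163, n° 15 Thm 3
  p. 163.
* [Rangarao1993] R. Ranga Rao, Pacific J. Math. 157 (1993): Lemma 3.2 and (3.12) pp. 351–352; (4.1) and Thm 4.1
  (4) p. 358; p. 336.
-/

set_option autoImplicit false

noncomputable section

namespace Literature.RepresentationTheory.HeisenbergGroup

open _root_.MeasureTheory Matrix Filter
open Literature.NumberTheory.Automorphic
open Literature.NumberTheory.GaloisRepresentations.IsNonarchimedeanLocalField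
open Literature.NumberTheory.Weil1964
open Literature.LinearAlgebra.QuadraticForm

/-! ## §0 Algebraic complements -/

section Algebra

variable {F : Type*} [Field F] {ι : Type*} [Fintype ι] [DecidableEq ι]

/-- for `S` symmetric, `ᵗS⁻¹ = S⁻¹`: `dualLeviPi S = S.symm`. [cite: Weil1964, n° 7, (9), p. 153] -/
theorem dualLeviPi_eq_symm_of_symm (S : (ι → F) ≃ₗ[F] (ι → F)) (hS : ∀ x y : ι → F, x ⬝ᵥ S y = y ⬝ᵥ S x) :
    dualLeviPi S = S.symm := by
  refine LinearEquiv.ext fun v => dotProduct_eq _ _ fun t => ?_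
  rw [dotProduct_comm, dotProduct_dualLeviPi, dotProduct_comm, symm_dotProduct_of_dotProduct S hS, dotProduct_comm]

/-- `ᵗa (ᵗa⁻¹ z) = z`. [cite: Weil1964, n° 6, p. 151] -/
theorem transposePi_dualLeviPi_apply (a : (ι → F) ≃ₗ[F] (ι → F)) (z : ι → F) : transposePi a (dualLeviPi a z) = z := by
  rw [dualLeviPi, ← transposePi_symm, LinearEquiv.apply_symm_apply]

/-- `dualLeviPi (-1) = -1`. [cite: Weil1964, n° 6, p. 151] -/
theorem dualLeviPi_negEquiv : dualLeviPi (LinearEquiv.neg F : (ι → F) ≃ₗ[F] (ι → F)) = LinearEquiv.neg F :=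
  LinearEquiv.ext fun z => dualLeviPi_neg z

omit [Fintype ι] [DecidableEq ι] in
/-- `(-1)(-1) = 1` in `GL(F^ι)`. [cite: Weil1964, n° 6, p. 151] -/
theorem negEquiv_mul_negEquiv : (LinearEquiv.neg F * LinearEquiv.neg F : (ι → F) ≃ₗ[F] (ι → F)) = 1 :=
  LinearEquiv.ext fun z => by simp

omit [Fintype ι] [DecidableEq ι] in
/-- `(f g)⁻¹ v = g⁻¹ (f⁻¹ v)` in `GL`. [cite: Weil1964, n° 6, p. 151] -/
theorem symm_mul_apply (f g : (ι → F) ≃ₗ[F] (ι → F)) (v : ι → F) : (f * g).symm v = g.symm (f.symm v) := rfl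

omit [Fintype ι] [DecidableEq ι] in
/-- the underlying linear map of `(-1)·S` is `-S`. [cite: Weil1964, n° 14, p. 161] -/
theorem coe_neg_mul (S : (ι → F) ≃ₗ[F] (ι → F)) :
    ((LinearEquiv.neg F * S : (ι → F) ≃ₗ[F] (ι → F)) : (ι → F) →ₗ[F] (ι → F)) = -(S : (ι → F) →ₗ[F] (ι → F)) := by
  ext x; simp

omit [Fintype ι] [DecidableEq ι] in
/-- and that of its inverse is `-S⁻¹`. [cite: Weil1964, n° 14, p. 161] -/
theorem coe_neg_mul_symm (S : (ι → F) ≃ₗ[F] (ι → F)) :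
    (((LinearEquiv.neg F * S : (ι → F) ≃ₗ[F] (ι → F)).symm : (ι → F) ≃ₗ[F] (ι → F)) : (ι → F) →ₗ[F] (ι → F)) =
      -(S.symm : (ι → F) →ₗ[F] (ι → F)) := by
  ext x
  simp only [LinearEquiv.coe_coe, LinearMap.neg_apply, symm_mul_apply, LinearEquiv.symm_neg, LinearEquiv.neg_apply,
    map_neg]

variable [Invertible (2 : F)]

omit [DecidableEq ι] in
/-- `-q_{-s} = -(-q_s)`. [cite: Weil1964, Chap. I n° 14, p. 161] -/
theorem negHalfQF_neg (s : (ι → F) →ₗ[F] (ι → F)) : negHalfQF (-s) = -negHalfQF s := by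
  refine QuadraticMap.ext fun x => ?_
  rw [QuadraticMap.neg_apply, negHalfQF_apply, negHalfQF_apply, halfForm_apply, halfForm_apply, LinearMap.neg_apply,
    dotProduct_neg, mul_neg]

end Algebra

section Ops

variable {F : Type*} [Field F] [ValuativeRel F] [TopologicalSpace F] [IsNonarchimedeanLocalField F]
  {ι : Type*} [Fintype ι] [DecidableEq ι] [Invertible (2 : F)]
  {ψ : AddChar F Circle} (hl : IsLocallyConstant (⇑ψ : F → Circle))
  (hb : ∀ y : ι → F, Continuous fun u : ι → F => dotProductBilin F F u y)
  [MeasurableSpace F] [BorelSpace F] (μ : Measure F) [μ.IsAddHaarMeasure] {m : ℤ}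

local notation "𝕍" => ((ι → F) × (ι → F))
local notation "Spι" => (symplecticGroup (polar (dotProductBilin F F (m := ι))))
local notation "𝐧" => unipotentSp (dotProductBilin F F (m := ι))
local notation "𝐦" a:max => leviSp (dotProductBilin F F (m := ι)) a (dualLeviPi a) (dotProductBilin_apply_dualLeviPi a)
local notation "𝐰" => weylSp (dotProductBilin F F (m := ι)) (LinearEquiv.refl F (ι → F)) (LinearEquiv.neg F)
  dotProductBilin_refl_neg'

/-! ## §1 `|κ(S)| = 1` and `κ(S) = γ(-q_S)` for the self-dual measure -/

omit [Field F] [ValuativeRel F] [IsNonarchimedeanLocalField F] [Fintype ι] [DecidableEq ι] [Invertible (2 : F)]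
  [MeasurableSpace F] [BorelSpace F] in
/-- scalars commute with every operator. [cite: MoeglinVignerasWaldspurger1987, Chap. 2 II.1 (B)] -/
theorem mul_scalarOp (A : SchwartzBruhat (ι → F) ≃ₗ[ℂ] SchwartzBruhat (ι → F)) (u : ℂˣ) :
    A * scalarOp u = scalarOp u * A := by
  apply LinearEquiv.ext; intro f
  rw [LinearEquiv.mul_apply, LinearEquiv.mul_apply, scalarOp_apply, scalarOp_apply, map_smul]

omit [Field F] [ValuativeRel F] [IsNonarchimedeanLocalField F] [Fintype ι] [DecidableEq ι] [Invertible (2 : F)]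
  [MeasurableSpace F] [BorelSpace F] in
/-- `(u·1)(v·1) = (uv)·1`. [cite: MoeglinVignerasWaldspurger1987, Chap. 2 II.1 (B)] -/
theorem scalarOp_mul_scalarOp (u v : ℂˣ) :
    scalarOp (S := SchwartzBruhat (ι → F)) u * scalarOp v = scalarOp (u * v) := by
  apply LinearEquiv.ext; intro f
  rw [LinearEquiv.mul_apply, scalarOp_apply, scalarOp_apply, scalarOp_apply, Units.val_mul, smul_smul]

omit [DecidableEq ι] [Invertible (2 : F)] [MeasurableSpace F] [BorelSpace F] in
/-- `u·1 = 1` on `𝒮(F^ι) ≠ 0` forces `u = 1`. [cite: MoeglinVignerasWaldspurger1987, Chap. 2 II.1 (B)] -/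
theorem eq_one_of_scalarOp_eq_one {u : ℂˣ} (h : scalarOp (S := SchwartzBruhat (ι → F)) u = 1) : u = 1 := by
  obtain ⟨f, hf⟩ := exists_ne (0 : SchwartzBruhat (ι → F))
  have h1 := LinearEquiv.congr_fun h f
  rw [scalarOp_apply, LinearEquiv.coe_one, id_eq] at h1
  exact Units.ext (smul_left_injective ℂ hf (h1.trans (one_smul ℂ f).symm))

omit [MeasurableSpace F] [BorelSpace F] in
/-- `r(m(-1))` commutes with the unipotent operators (`ψ(-½⟨x, cx⟩)` is even).
[cite: Weil1964, n° 13, p. 160] -/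
theorem leviOpPi_neg_mul_unipOpPi (c : (ι → F) →ₗ[F] (ι → F)) :
    leviOpPi (LinearEquiv.neg F) * unipOpPi hl c = unipOpPi hl c * leviOpPi (LinearEquiv.neg F) := by
  have e : (((dualLeviPi (LinearEquiv.neg F) : (ι → F) ≃ₗ[F] (ι → F)) : (ι → F) →ₗ[F] (ι → F)) ∘ₗ c ∘ₗ
      (((LinearEquiv.neg F).symm : (ι → F) ≃ₗ[F] (ι → F)) : (ι → F) →ₗ[F] (ι → F))) = c := by
    ext x
    simp only [LinearMap.comp_apply, LinearEquiv.coe_coe, LinearEquiv.symm_neg, LinearEquiv.neg_apply, map_neg,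
      dualLeviPi_neg, neg_neg]
  rw [leviOpPi_mul_unipOpPi, e]

omit [ValuativeRel F] [TopologicalSpace F] [IsNonarchimedeanLocalField F] [DecidableEq ι] [Invertible (2 : F)]
  [MeasurableSpace F] [BorelSpace F] in
/-- `-S` is symmetric with `S`. [cite: Weil1964, Chap. I n° 14, p. 161] -/
private theorem symm_negMul (S : (ι → F) ≃ₗ[F] (ι → F)) (hS : ∀ x y : ι → F, x ⬝ᵥ S y = y ⬝ᵥ S x) :
    ∀ x y : ι → F, x ⬝ᵥ (LinearEquiv.neg F * S : (ι → F) ≃ₗ[F] (ι → F)) y =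
      y ⬝ᵥ (LinearEquiv.neg F * S : (ι → F) ≃ₗ[F] (ι → F)) x := fun x y => by
  simp only [LinearEquiv.mul_apply, LinearEquiv.neg_apply, dotProduct_neg, hS x y]

/-- **`κ(S) κ(-S) = 1` for the self-dual measure** — from Weil's identity for `S` and `-S`:
`[r(w)r(n(S))r(w)] [r(w)r(n(-S))r(w)] = r(w) r(n(S)) r(m(-1)) r(n(-S)) r(w) = r(w) r(m(-1)) r(w) = 1` while the
right-hand sides multiply to `κ(S)κ(-S) · 1`. [cite: Weil1964, Chap. I n° 14 Thm 2 Cor. 2, p. 162; n° 15 Thm 3] -/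
theorem weilKappa_mul_weilKappa_neg (hl : IsLocallyConstant (⇑ψ : F → Circle)) (hψ : ψ.IsContinuousNontrivial) (hm : ψ.HasConductorExp m)
    (hμ : IsSelfDualMeasure ψ μ) (S : (ι → F) ≃ₗ[F] (ι → F)) (hS : ∀ x y : ι → F, x ⬝ᵥ S y = y ⬝ᵥ S x) :
    weilKappa μ (ψ := ψ) S * weilKappa μ (ψ := ψ) (LinearEquiv.neg F * S) = 1 := by
  have hS' := symm_negMul S hS
  have h1 := fourierOpPi_mul_unipOpPi_mul_fourierOpPi (hl := hl) (μ := μ) hψ hm S hS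
  have h2 := fourierOpPi_mul_unipOpPi_mul_fourierOpPi (hl := hl) (μ := μ) hψ hm (LinearEquiv.neg F * S) hS'
  rw [coe_neg_mul_symm, neg_neg] at h2
  -- the left-hand sides multiply to `1`
  have hL : (fourierOpPi μ hψ hm * unipOpPi hl (S : (ι → F) →ₗ[F] (ι → F)) * fourierOpPi μ hψ hm) *
      (fourierOpPi μ hψ hm * unipOpPi hl ((LinearEquiv.neg F * S : (ι → F) ≃ₗ[F] (ι → F)) :
        (ι → F) →ₗ[F] (ι → F)) * fourierOpPi μ hψ hm) = 1 := by
    rw [coe_neg_mul]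
    calc fourierOpPi μ hψ hm * unipOpPi hl (S : (ι → F) →ₗ[F] (ι → F)) * fourierOpPi μ hψ hm *
          (fourierOpPi μ hψ hm * unipOpPi hl (-(S : (ι → F) →ₗ[F] (ι → F))) * fourierOpPi μ hψ hm)
        = fourierOpPi μ hψ hm * (unipOpPi hl (S : (ι → F) →ₗ[F] (ι → F)) *
            ((fourierOpPi μ hψ hm * fourierOpPi μ hψ hm) * (unipOpPi hl (-(S : (ι → F) →ₗ[F] (ι → F))) *
              fourierOpPi μ hψ hm))) := by simp only [mul_assoc]
      _ = fourierOpPi μ hψ hm * (leviOpPi (LinearEquiv.neg F) * ((unipOpPi hl (S : (ι → F) →ₗ[F] (ι → F)) *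
            unipOpPi hl (-(S : (ι → F) →ₗ[F] (ι → F)))) * fourierOpPi μ hψ hm)) := by
          rw [fourierOpPi_mul_fourierOpPi μ hψ hm hμ, ← mul_assoc (unipOpPi hl _) (leviOpPi _),
            ← leviOpPi_neg_mul_unipOpPi hl]
          simp only [mul_assoc]
      _ = leviOpPi (LinearEquiv.neg F) * leviOpPi (LinearEquiv.neg F : (ι → F) ≃ₗ[F] (ι → F)) := by
          rw [← unipOpPi_add, add_neg_cancel, unipOpPi_zero, one_mul, ← mul_assoc, fourierOpPi_mul_leviOpPi,
            dualLeviPi_negEquiv, mul_assoc, fourierOpPi_mul_fourierOpPi μ hψ hm hμ]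
      _ = 1 := by rw [← leviOpPi_mul, negEquiv_mul_negEquiv, leviOpPi_one]
  -- the right-hand sides multiply to `κ(S) κ(-S) · 1`
  have hP : (unipOpPi hl (-(S.symm : (ι → F) →ₗ[F] (ι → F))) * leviOpPi S * fourierOpPi μ hψ hm *
        unipOpPi hl (-(S.symm : (ι → F) →ₗ[F] (ι → F)))) *
      (unipOpPi hl (S.symm : (ι → F) →ₗ[F] (ι → F)) * leviOpPi (LinearEquiv.neg F * S) * fourierOpPi μ hψ hm *
        unipOpPi hl (S.symm : (ι → F) →ₗ[F] (ι → F))) = 1 := by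
    have e : S * dualLeviPi (LinearEquiv.neg F * S) * LinearEquiv.neg F = 1 := by
      rw [dualLeviPi_mul, dualLeviPi_negEquiv, dualLeviPi_eq_symm_of_symm S hS]
      refine LinearEquiv.ext fun x => ?_
      simp [LinearEquiv.mul_apply]
    calc (unipOpPi hl (-(S.symm : (ι → F) →ₗ[F] (ι → F))) * leviOpPi S * fourierOpPi μ hψ hm *
          unipOpPi hl (-(S.symm : (ι → F) →ₗ[F] (ι → F)))) *
        (unipOpPi hl (S.symm : (ι → F) →ₗ[F] (ι → F)) * leviOpPi (LinearEquiv.neg F * S) * fourierOpPi μ hψ hm *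
          unipOpPi hl (S.symm : (ι → F) →ₗ[F] (ι → F)))
        = unipOpPi hl (-(S.symm : (ι → F) →ₗ[F] (ι → F))) * (leviOpPi S * (fourierOpPi μ hψ hm *
            ((unipOpPi hl (-(S.symm : (ι → F) →ₗ[F] (ι → F))) * unipOpPi hl (S.symm : (ι → F) →ₗ[F] (ι → F))) *
              (leviOpPi (LinearEquiv.neg F * S) * (fourierOpPi μ hψ hm *
                unipOpPi hl (S.symm : (ι → F) →ₗ[F] (ι → F))))))) := by simp only [mul_assoc]
      _ = unipOpPi hl (-(S.symm : (ι → F) →ₗ[F] (ι → F))) * ((leviOpPi S * leviOpPi (dualLeviPi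
            (LinearEquiv.neg F * S)) * (fourierOpPi μ hψ hm * fourierOpPi μ hψ hm)) *
              unipOpPi hl (S.symm : (ι → F) →ₗ[F] (ι → F))) := by
          rw [← unipOpPi_add, neg_add_cancel, unipOpPi_zero, one_mul, ← mul_assoc (fourierOpPi μ hψ hm)
            (leviOpPi _), fourierOpPi_mul_leviOpPi]
          simp only [mul_assoc]
      _ = 1 := by
          rw [fourierOpPi_mul_fourierOpPi μ hψ hm hμ, ← leviOpPi_mul, ← leviOpPi_mul, e, leviOpPi_one, one_mul,
            ← unipOpPi_add, neg_add_cancel, unipOpPi_zero]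
  rw [h1, h2] at hL
  set P₁ := unipOpPi hl (-(S.symm : (ι → F) →ₗ[F] (ι → F))) * leviOpPi S * fourierOpPi μ hψ hm *
      unipOpPi hl (-(S.symm : (ι → F) →ₗ[F] (ι → F)))
  set P₂ := unipOpPi hl (S.symm : (ι → F) →ₗ[F] (ι → F)) * leviOpPi (LinearEquiv.neg F * S) *
    fourierOpPi μ hψ hm * unipOpPi hl (S.symm : (ι → F) →ₗ[F] (ι → F))
  set z₁ := scalarOp (S := SchwartzBruhat (ι → F)) (Units.mk0 (weilKappa μ (ψ := ψ) S)
    (weilKappa_ne_zero μ hψ S hS))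
  set z₂ := scalarOp (S := SchwartzBruhat (ι → F)) (Units.mk0 (weilKappa μ (ψ := ψ) (LinearEquiv.neg F * S))
    (weilKappa_ne_zero μ hψ (LinearEquiv.neg F * S) hS'))
  have comm : P₁ * z₂ = z₂ * P₁ := mul_scalarOp P₁ _
  have key : z₁ * z₂ = 1 :=
    calc z₁ * z₂ = z₁ * z₂ * (P₁ * P₂) := by rw [hP, mul_one]
      _ = z₁ * (z₂ * P₁) * P₂ := by simp only [mul_assoc]
      _ = z₁ * (P₁ * z₂) * P₂ := by rw [comm]
      _ = z₁ * P₁ * (z₂ * P₂) := by simp only [mul_assoc]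
      _ = 1 := hL
  have hs : scalarOp (S := SchwartzBruhat (ι → F)) (Units.mk0 (weilKappa μ (ψ := ψ) S)
      (weilKappa_ne_zero μ hψ S hS) * Units.mk0 (weilKappa μ (ψ := ψ) (LinearEquiv.neg F * S))
        (weilKappa_ne_zero μ hψ (LinearEquiv.neg F * S) hS')) = 1 := by
    rw [← scalarOp_mul_scalarOp]; exact key
  have := congrArg (fun u : ℂˣ => (u : ℂ)) (eq_one_of_scalarOp_eq_one hs)
  simpa only [Units.val_mul, Units.val_mk0, Units.val_one] using this

omit [DecidableEq ι] in
/-- `g(-f) = conj g(f)` for Weil's stable Gauss integral of a non-degenerate form. [cite: Weil1964, Chap. II n° 25, p. 173] -/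
theorem weilGaussQF_neg_eq_conj (hψ : ψ.IsContinuousNontrivial) {Q : QuadraticForm F (ι → F)}
    (hQ : (QuadraticMap.associated (R := F) Q).SeparatingLeft) :
    weilGaussQF ψ μ (-Q) = (starRingEnd ℂ) (weilGaussQF ψ μ Q) := by
  have hQ' : (QuadraticMap.associated (R := F) (-Q)).SeparatingLeft := fun x hx => hQ x fun y => by
    have := hx y
    rwa [map_neg, LinearMap.neg_apply, LinearMap.neg_apply, neg_eq_zero] at this
  obtain ⟨N, hN⟩ := ((eventually_gaussQF_primePowPiBox_eq μ hψ hQ).and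
    (eventually_gaussQF_primePowPiBox_eq μ hψ hQ')).exists
  rw [← hN.2, ← hN.1, gaussQF_neg]

omit [DecidableEq ι] in
/-- `κ(-S) = conj κ(S)`. [cite: Weil1964, Chap. I n° 14, p. 161; Chap. II n° 25, p. 173] -/
theorem weilKappa_negMul (hψ : ψ.IsContinuousNontrivial) (S : (ι → F) ≃ₗ[F] (ι → F))
    (hS : ∀ x y : ι → F, x ⬝ᵥ S y = y ⬝ᵥ S x) :
    weilKappa μ (ψ := ψ) (LinearEquiv.neg F * S) = (starRingEnd ℂ) (weilKappa μ (ψ := ψ) S) := by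
  rw [weilKappa, weilKappa, coe_neg_mul, negHalfQF_neg,
    weilGaussQF_neg_eq_conj μ hψ (separatingLeft_associated_negHalfQF S hS), modSqrt_mul, modSqrt_neg_one, one_mul,
    _root_.map_mul, Complex.conj_ofReal]

/-- **`|κ(S)| = 1` for the self-dual measure** (Weil: `|γ(f)| = 1`; Rao: the multiplier "is a complex number of
absolute value one"). [cite: Weil1964, Chap. I n° 14 Thm 2 Cor. 2, p. 162; Rangarao1993, (4.1), p. 358] -/
theorem norm_weilKappa (hl : IsLocallyConstant (⇑ψ : F → Circle)) (hψ : ψ.IsContinuousNontrivial) (hm : ψ.HasConductorExp m) (hμ : IsSelfDualMeasure ψ μ)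
    (S : (ι → F) ≃ₗ[F] (ι → F)) (hS : ∀ x y : ι → F, x ⬝ᵥ S y = y ⬝ᵥ S x) : ‖weilKappa μ (ψ := ψ) S‖ = 1 := by
  have h := weilKappa_mul_weilKappa_neg (hl := hl) (μ := μ) hψ hm hμ S hS
  rw [weilKappa_negMul μ hψ S hS, Complex.mul_conj] at h
  have h2 : ‖weilKappa μ (ψ := ψ) S‖ ^ 2 = 1 := by
    rw [← Complex.normSq_eq_norm_sq]; exact_mod_cast h
  exact (pow_eq_one_iff_of_nonneg (norm_nonneg _) two_ne_zero).1 h2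

/-- **`κ(S) = γ_ψ(-q_S)`**: for the self-dual measure Weil's constant IS the Weil index of `x ↦ -½⟨x, Sx⟩`
(`|g(-q_S)| |det S|^{1/2} = 1`). [cite: Weil1964, Chap. I n° 14 Thm 2 and Cor. 2, pp. 161–162; Rangarao1993, Thm 4.1 (4)] -/
theorem weilKappa_eq_weilIndexQF (hl : IsLocallyConstant (⇑ψ : F → Circle)) (hψ : ψ.IsContinuousNontrivial) (hm : ψ.HasConductorExp m)
    (hμ : IsSelfDualMeasure ψ μ) (S : (ι → F) ≃ₗ[F] (ι → F)) (hS : ∀ x y : ι → F, x ⬝ᵥ S y = y ⬝ᵥ S x) :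
    weilKappa μ (ψ := ψ) S = weilIndexQF ψ μ (negHalfQF (S : (ι → F) →ₗ[F] (ι → F))) := by
  have hn := norm_weilKappa (hl := hl) (μ := μ) hψ hm hμ S hS
  rw [weilKappa, norm_mul, Complex.norm_real, Real.norm_of_nonneg (modSqrt_pos S).le] at hn
  rw [weilKappa, weilIndexQF_def, div_eq_mul_inv, eq_inv_of_mul_eq_one_right hn, Complex.ofReal_inv]

/-! ## §2 The big-cell section -/

open scoped Classical in
/-- **the Schrödinger big-cell section**: `r(g) = r(n(DB⁻¹)) r(m(B)) r(w) r(n(B⁻¹A))` for `g = (A B; C D)` in the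
big cell (`B` invertible), `1` elsewhere (Weil's `r(s)` on `Ω(W)`; Rao's standard `r(σ)` restricted to the big
cell, with the normalisation `|det B|^{-1/2}` built into `r(m(B))`).
[cite: Weil1964, n° 13 (29), p. 160; Rangarao1993, (3.12), p. 352] -/
def bigCellOp (hψ : ψ.IsContinuousNontrivial) (hm : ψ.HasConductorExp m) (g : Spι) :
    SchwartzBruhat (ι → F) ≃ₗ[ℂ] SchwartzBruhat (ι → F) :=
  if hB : Function.Bijective (blockB (g : 𝕍 ≃ₗ[F] 𝕍)) then
    unipOpPi hl (cellGamma (g : 𝕍 ≃ₗ[F] 𝕍) hB) * leviOpPi (cellB (g : 𝕍 ≃ₗ[F] 𝕍) hB) * fourierOpPi μ hψ hm *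
      unipOpPi hl (cellDelta (g : 𝕍 ≃ₗ[F] 𝕍) hB)
  else 1

omit [DecidableEq ι] in
/-- definition unfolded on the big cell. [cite: Weil1964, n° 13 (29), p. 160] -/
theorem bigCellOp_of_bijective (hψ : ψ.IsContinuousNontrivial) (hm : ψ.HasConductorExp m) (g : Spι)
    (hB : Function.Bijective (blockB (g : 𝕍 ≃ₗ[F] 𝕍))) :
    bigCellOp hl μ hψ hm g =
      unipOpPi hl (cellGamma (g : 𝕍 ≃ₗ[F] 𝕍) hB) * leviOpPi (cellB (g : 𝕍 ≃ₗ[F] 𝕍) hB) * fourierOpPi μ hψ hm *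
        unipOpPi hl (cellDelta (g : 𝕍 ≃ₗ[F] 𝕍) hB) := by
  rw [bigCellOp, dif_pos hB]

/-- **value on canonical words**: `r(n(γ) m(B) w n(δ)) = r(n(γ)) r(m(B)) r(w) r(n(δ))`.
[cite: Weil1964, n° 13 (29), p. 160; Rangarao1993, (3.12), p. 352] -/
theorem bigCellOp_canonicalWord (hψ : ψ.IsContinuousNontrivial) (hm : ψ.HasConductorExp m)
    (γ δ : (ι → F) →ₗ[F] (ι → F))
    (hγ : ∀ x x' : ι → F, dotProductBilin F F x (γ x') = dotProductBilin F F x' (γ x))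
    (hδ : ∀ x x' : ι → F, dotProductBilin F F x (δ x') = dotProductBilin F F x' (δ x))
    (Bₑ : (ι → F) ≃ₗ[F] (ι → F)) :
    bigCellOp hl μ hψ hm (𝐧 γ hγ * 𝐦 Bₑ * 𝐰 * 𝐧 δ hδ) =
      unipOpPi hl γ * leviOpPi Bₑ * fourierOpPi μ hψ hm * unipOpPi hl δ := by
  have hBB : ∀ y, blockB ((𝐧 γ hγ * 𝐦 Bₑ * 𝐰 * 𝐧 δ hδ : Spι) : 𝕍 ≃ₗ[F] 𝕍) y = Bₑ y :=
    blockB_canonicalWord γ δ hγ hδ Bₑ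
  have hB : Function.Bijective (blockB ((𝐧 γ hγ * 𝐦 Bₑ * 𝐰 * 𝐧 δ hδ : Spι) : 𝕍 ≃ₗ[F] 𝕍)) := by
    have : blockB ((𝐧 γ hγ * 𝐦 Bₑ * 𝐰 * 𝐧 δ hδ : Spι) : 𝕍 ≃ₗ[F] 𝕍) = (Bₑ : (ι → F) →ₗ[F] (ι → F)) :=
      LinearMap.ext hBB
    rw [this]; exact Bₑ.bijective
  have e1 : cellB ((𝐧 γ hγ * 𝐦 Bₑ * 𝐰 * 𝐧 δ hδ : Spι) : 𝕍 ≃ₗ[F] 𝕍) hB = Bₑ := LinearEquiv.ext hBB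
  have e2 : cellGamma ((𝐧 γ hγ * 𝐦 Bₑ * 𝐰 * 𝐧 δ hδ : Spι) : 𝕍 ≃ₗ[F] 𝕍) hB = γ := by
    apply LinearMap.ext; intro x
    rw [cellGamma_apply, e1, blockD_canonicalWord, LinearEquiv.apply_symm_apply]
  have e3 : cellDelta ((𝐧 γ hγ * 𝐦 Bₑ * 𝐰 * 𝐧 δ hδ : Spι) : 𝕍 ≃ₗ[F] 𝕍) hB = δ := by
    apply LinearMap.ext; intro x
    rw [cellDelta_apply, e1, blockA_canonicalWord, LinearEquiv.symm_apply_apply]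
  rw [bigCellOp_of_bijective hl μ hψ hm _ hB, e2, e3, e1]

/-- **the big-cell section implements**: `(g, r(g)) ∈ S̃p_ψ(W)` for `g` in the big cell.
[cite: Weil1964, n° 13, p. 160; Rangarao1993, Lemma 3.2, p. 351] -/
theorem bigCellOp_mem_MpPsi (hψ : ψ.IsContinuousNontrivial) (hm : ψ.HasConductorExp m) (g : Spι)
    (hB : Function.Bijective (blockB (g : 𝕍 ≃ₗ[F] 𝕍))) :
    (g, bigCellOp hl μ hψ hm g) ∈ MpPsi (schrodingerSB (dotProductBilin F F (m := ι)) ψ hl hb) := by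
  have e : (g, bigCellOp hl μ hψ hm g) =
      (𝐧 (cellGamma (g : 𝕍 ≃ₗ[F] 𝕍) hB) (cellGamma_symm g hB), unipOpPi hl (cellGamma (g : 𝕍 ≃ₗ[F] 𝕍) hB)) *
        (𝐦 (cellB (g : 𝕍 ≃ₗ[F] 𝕍) hB), leviOpPi (cellB (g : 𝕍 ≃ₗ[F] 𝕍) hB)) *
        (𝐰, fourierOpPi μ hψ hm) *
        (𝐧 (cellDelta (g : 𝕍 ≃ₗ[F] 𝕍) hB) (cellDelta_symm g hB), unipOpPi hl (cellDelta (g : 𝕍 ≃ₗ[F] 𝕍) hB)) := by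
    rw [Prod.mk_mul_mk, Prod.mk_mul_mk, Prod.mk_mul_mk, ← eq_canonicalWord g hB, bigCellOp_of_bijective hl μ hψ hm g hB]
  rw [e]
  exact Subgroup.mul_mem _ (Subgroup.mul_mem _ (Subgroup.mul_mem _
    (unipotent_unipOpPi_mem_MpPsi hl hb _ _) (levi_leviOpPi_mem_MpPsi hl hb _))
    (weyl_fourierOpPi_mem_MpPsi hl hb μ hψ hm)) (unipotent_unipOpPi_mem_MpPsi hl hb _ _)

/-- `r(1) = 1` (`1` is off the big cell: its `B`-block is `0`). [cite: Weil1964, n° 13, p. 160] -/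
theorem bigCellOp_one [Nonempty ι] (hψ : ψ.IsContinuousNontrivial) (hm : ψ.HasConductorExp m) :
    bigCellOp hl μ hψ hm (1 : Spι) = 1 := by
  have hB : ¬ Function.Bijective (blockB ((1 : Spι) : 𝕍 ≃ₗ[F] 𝕍)) := by
    intro h
    obtain ⟨i⟩ := ‹Nonempty ι›
    have h1 : blockB ((1 : Spι) : 𝕍 ≃ₗ[F] 𝕍) (Pi.single i 1) = blockB ((1 : Spι) : 𝕍 ≃ₗ[F] 𝕍) 0 := by
      simp [blockB_apply]
    have := congr_fun (h.1 h1) i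
    simp at this
  rw [bigCellOp, dif_neg hB]

/-! ## §3 Weil's multiplication formula on the big cell -/

omit [ValuativeRel F] [TopologicalSpace F] [IsNonarchimedeanLocalField F] [Invertible (2 : F)] [MeasurableSpace F]
  [BorelSpace F] in
/-- `T = ᵗB₂ (δ₁ + γ₂) B₂` is symmetric. [cite: Weil1964, n° 15, p. 163] -/
theorem symm_of_coe_eq {γ δ : (ι → F) →ₗ[F] (ι → F)}
    (hδ : ∀ x x' : ι → F, dotProductBilin F F x (δ x') = dotProductBilin F F x' (δ x))
    (hγ : ∀ x x' : ι → F, dotProductBilin F F x (γ x') = dotProductBilin F F x' (γ x))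
    (B₂ Tₑ : (ι → F) ≃ₗ[F] (ι → F))
    (hT : (Tₑ : (ι → F) →ₗ[F] (ι → F)) =
      ((transposePi B₂ : (ι → F) ≃ₗ[F] (ι → F)) : (ι → F) →ₗ[F] (ι → F)) ∘ₗ (δ + γ) ∘ₗ
        ((B₂ : (ι → F) ≃ₗ[F] (ι → F)) : (ι → F) →ₗ[F] (ι → F))) :
    ∀ x y : ι → F, x ⬝ᵥ Tₑ y = y ⬝ᵥ Tₑ x := fun x y => by
  have h := symm_transposePi_comp (symm_add hδ hγ) B₂ x y
  rw [← hT, dotProductBilin_apply_apply, dotProductBilin_apply_apply, LinearEquiv.coe_coe] at h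
  exact h

omit [ValuativeRel F] [TopologicalSpace F] [IsNonarchimedeanLocalField F] [DecidableEq ι] [Invertible (2 : F)]
  [MeasurableSpace F] [BorelSpace F] in
/-- `-T⁻¹` is symmetric (β-form). [cite: Weil1964, n° 15, p. 163] -/
theorem symm_neg_symm (Tₑ : (ι → F) ≃ₗ[F] (ι → F)) (hTs : ∀ x y : ι → F, x ⬝ᵥ Tₑ y = y ⬝ᵥ Tₑ x) :
    ∀ x x' : ι → F, dotProductBilin F F x ((-(Tₑ.symm : (ι → F) →ₗ[F] (ι → F))) x') =
      dotProductBilin F F x' ((-(Tₑ.symm : (ι → F) →ₗ[F] (ι → F))) x) := fun x x' => by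
  simp only [LinearMap.neg_apply, map_neg, dotProductBilin_apply_apply, LinearEquiv.coe_coe,
    symm_dotProduct_of_dotProduct Tₑ hTs x x']

omit [ValuativeRel F] [TopologicalSpace F] [IsNonarchimedeanLocalField F] [MeasurableSpace F] [BorelSpace F] in
/-- the `B`-block of a product of canonical words: `B(g₁g₂) = B₁ (δ₁ + γ₂) B₂`. [cite: Weil1964, n° 15, p. 163] -/
theorem blockB_canonicalWord_mul (γ₁ δ₁ γ₂ δ₂ : (ι → F) →ₗ[F] (ι → F))
    (hγ₁ : ∀ x x' : ι → F, dotProductBilin F F x (γ₁ x') = dotProductBilin F F x' (γ₁ x))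
    (hδ₁ : ∀ x x' : ι → F, dotProductBilin F F x (δ₁ x') = dotProductBilin F F x' (δ₁ x))
    (hγ₂ : ∀ x x' : ι → F, dotProductBilin F F x (γ₂ x') = dotProductBilin F F x' (γ₂ x))
    (hδ₂ : ∀ x x' : ι → F, dotProductBilin F F x (δ₂ x') = dotProductBilin F F x' (δ₂ x))
    (B₁ B₂ : (ι → F) ≃ₗ[F] (ι → F)) (y : ι → F) :
    blockB (((𝐧 γ₁ hγ₁ * 𝐦 B₁ * 𝐰 * 𝐧 δ₁ hδ₁) * (𝐧 γ₂ hγ₂ * 𝐦 B₂ * 𝐰 * 𝐧 δ₂ hδ₂) : Spι) : 𝕍 ≃ₗ[F] 𝕍) y =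
      B₁ ((δ₁ + γ₂) (B₂ y)) := by
  rw [Subgroup.coe_mul, blockB_mul_apply, blockA_canonicalWord, blockB_canonicalWord, blockB_canonicalWord,
    blockD_canonicalWord, LinearMap.add_apply, map_add]

omit [ValuativeRel F] [TopologicalSpace F] [IsNonarchimedeanLocalField F] [MeasurableSpace F] [BorelSpace F] in
/-- **the product of two canonical words with `T = ᵗB₂(δ₁ + γ₂)B₂` invertible is the canonical word
`n(γ₁ + M) m(B₁ ᵗB₂⁻¹ T) w n(δ₂ - T⁻¹)`**, `M = ᵗ(B₁ᵗB₂⁻¹)⁻¹ (-T⁻¹) (B₁ᵗB₂⁻¹)⁻¹` — the group-theoretic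
content of `r(s) r(s') = γ r(s'')` (via `w n(T) w = n(-T⁻¹) m(T) w n(-T⁻¹)`). [cite: Weil1964, n° 15 Thm 3, p. 163; n° 7 (9)] -/
theorem canonicalWord_mul_canonicalWord (γ₁ δ₁ γ₂ δ₂ : (ι → F) →ₗ[F] (ι → F))
    (hγ₁ : ∀ x x' : ι → F, dotProductBilin F F x (γ₁ x') = dotProductBilin F F x' (γ₁ x))
    (hδ₁ : ∀ x x' : ι → F, dotProductBilin F F x (δ₁ x') = dotProductBilin F F x' (δ₁ x))
    (hγ₂ : ∀ x x' : ι → F, dotProductBilin F F x (γ₂ x') = dotProductBilin F F x' (γ₂ x))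
    (hδ₂ : ∀ x x' : ι → F, dotProductBilin F F x (δ₂ x') = dotProductBilin F F x' (δ₂ x))
    (B₁ B₂ Tₑ : (ι → F) ≃ₗ[F] (ι → F))
    (hT : (Tₑ : (ι → F) →ₗ[F] (ι → F)) =
      ((transposePi B₂ : (ι → F) ≃ₗ[F] (ι → F)) : (ι → F) →ₗ[F] (ι → F)) ∘ₗ (δ₁ + γ₂) ∘ₗ
        ((B₂ : (ι → F) ≃ₗ[F] (ι → F)) : (ι → F) →ₗ[F] (ι → F))) :
    (𝐧 γ₁ hγ₁ * 𝐦 B₁ * 𝐰 * 𝐧 δ₁ hδ₁) * (𝐧 γ₂ hγ₂ * 𝐦 B₂ * 𝐰 * 𝐧 δ₂ hδ₂) =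
      𝐧 (γ₁ + (((dualLeviPi (B₁ * dualLeviPi B₂) : (ι → F) ≃ₗ[F] (ι → F)) : (ι → F) →ₗ[F] (ι → F)) ∘ₗ
          (-(Tₑ.symm : (ι → F) →ₗ[F] (ι → F))) ∘ₗ
          (((B₁ * dualLeviPi B₂).symm : (ι → F) ≃ₗ[F] (ι → F)) : (ι → F) →ₗ[F] (ι → F))))
        (symm_add hγ₁ (symm_dualLeviPi_comp (symm_neg_symm Tₑ (symm_of_coe_eq hδ₁ hγ₂ B₂ Tₑ hT)) _)) *
      𝐦 (B₁ * dualLeviPi B₂ * Tₑ) * 𝐰 *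
      𝐧 (-(Tₑ.symm : (ι → F) →ₗ[F] (ι → F)) + δ₂)
        (symm_add (symm_neg_symm Tₑ (symm_of_coe_eq hδ₁ hγ₂ B₂ Tₑ hT)) hδ₂) := by
  have hTs := symm_of_coe_eq hδ₁ hγ₂ B₂ Tₑ hT
  have hTa : ∀ v, Tₑ v = transposePi B₂ ((δ₁ + γ₂) (B₂ v)) := fun v => by
    have := LinearMap.congr_fun hT v
    simpa only [LinearEquiv.coe_coe, LinearMap.comp_apply] using this
  have hTd : dualLeviPi Tₑ = Tₑ.symm := dualLeviPi_eq_symm_of_symm Tₑ hTs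
  apply Subtype.ext; apply LinearEquiv.ext; rintro ⟨x, y⟩
  rw [Subgroup.coe_mul, LinearEquiv.mul_apply, canonicalWord_apply, canonicalWord_apply, canonicalWord_apply]
  simp only [LinearMap.add_apply, LinearMap.neg_apply, LinearMap.comp_apply, LinearEquiv.coe_coe, map_add, map_neg,
    map_sub, LinearEquiv.mul_apply, symm_mul_apply, dualLeviPi_mul, dualLeviPi_dualLeviPi, hTd, dualLeviPi_symm,
    LinearEquiv.symm_apply_apply, LinearEquiv.apply_symm_apply, transposePi_dualLeviPi_apply, Prod.mk.injEq]
  simp only [hTa, map_add, LinearMap.add_apply, dualLeviPi_transposePi_apply]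
  constructor
  · abel
  · abel

/-- **WEIL'S MULTIPLICATION FORMULA ON THE BIG CELL**: for canonical words `g₁, g₂` with `g₁g₂` in the big cell
(`T = ᵗB₂(δ₁ + γ₂)B₂` invertible), `r(g₁) r(g₂) = κ(T) · r(g₁g₂)` with `κ(T) = g(-q_T)|det T|^{1/2}` (`= γ(-q_T)`
for the self-dual measure, `weilKappa_eq_weilIndexQF`) — "`r(s) r(s') = γ(f₀) r(s'')`", the case of
[Rangarao1993] Thm 4.1 in which `σ₁, σ₂, σ₁σ₂` lie in the big cell. [cite: Weil1964, n° 15 Thm 3, p. 163; Rangarao1993, Thm 4.1 (4), p. 358] -/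
theorem bigCellOp_mul_bigCellOp (hψ : ψ.IsContinuousNontrivial) (hm : ψ.HasConductorExp m)
    (γ₁ δ₁ γ₂ δ₂ : (ι → F) →ₗ[F] (ι → F))
    (hγ₁ : ∀ x x' : ι → F, dotProductBilin F F x (γ₁ x') = dotProductBilin F F x' (γ₁ x))
    (hδ₁ : ∀ x x' : ι → F, dotProductBilin F F x (δ₁ x') = dotProductBilin F F x' (δ₁ x))
    (hγ₂ : ∀ x x' : ι → F, dotProductBilin F F x (γ₂ x') = dotProductBilin F F x' (γ₂ x))
    (hδ₂ : ∀ x x' : ι → F, dotProductBilin F F x (δ₂ x') = dotProductBilin F F x' (δ₂ x))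
    (B₁ B₂ Tₑ : (ι → F) ≃ₗ[F] (ι → F))
    (hT : (Tₑ : (ι → F) →ₗ[F] (ι → F)) =
      ((transposePi B₂ : (ι → F) ≃ₗ[F] (ι → F)) : (ι → F) →ₗ[F] (ι → F)) ∘ₗ (δ₁ + γ₂) ∘ₗ
        ((B₂ : (ι → F) ≃ₗ[F] (ι → F)) : (ι → F) →ₗ[F] (ι → F))) :
    bigCellOp hl μ hψ hm (𝐧 γ₁ hγ₁ * 𝐦 B₁ * 𝐰 * 𝐧 δ₁ hδ₁) * bigCellOp hl μ hψ hm (𝐧 γ₂ hγ₂ * 𝐦 B₂ * 𝐰 * 𝐧 δ₂ hδ₂) =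
      scalarOp (Units.mk0 (weilKappa μ (ψ := ψ) Tₑ) (weilKappa_ne_zero μ hψ Tₑ (symm_of_coe_eq hδ₁ hγ₂ B₂ Tₑ hT))) *
        bigCellOp hl μ hψ hm ((𝐧 γ₁ hγ₁ * 𝐦 B₁ * 𝐰 * 𝐧 δ₁ hδ₁) * (𝐧 γ₂ hγ₂ * 𝐦 B₂ * 𝐰 * 𝐧 δ₂ hδ₂)) := by
  have hTs := symm_of_coe_eq hδ₁ hγ₂ B₂ Tₑ hT
  have h4 := fourierOpPi_mul_unipOpPi_mul_fourierOpPi (hl := hl) (μ := μ) hψ hm Tₑ hTs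
  rw [canonicalWord_mul_canonicalWord γ₁ δ₁ γ₂ δ₂ hγ₁ hδ₁ hγ₂ hδ₂ B₁ B₂ Tₑ hT, bigCellOp_canonicalWord,
    bigCellOp_canonicalWord, bigCellOp_canonicalWord]
  set z := scalarOp (S := SchwartzBruhat (ι → F)) (Units.mk0 (weilKappa μ (ψ := ψ) Tₑ)
    (weilKappa_ne_zero μ hψ Tₑ hTs)) with hz
  have commz : ∀ A : SchwartzBruhat (ι → F) ≃ₗ[ℂ] SchwartzBruhat (ι → F), A * z = z * A :=
    fun A => mul_scalarOp A _
  calc unipOpPi hl γ₁ * leviOpPi B₁ * fourierOpPi μ hψ hm * unipOpPi hl δ₁ *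
        (unipOpPi hl γ₂ * leviOpPi B₂ * fourierOpPi μ hψ hm * unipOpPi hl δ₂)
      = unipOpPi hl γ₁ * (leviOpPi B₁ * (fourierOpPi μ hψ hm * ((unipOpPi hl δ₁ * unipOpPi hl γ₂) * (leviOpPi B₂ *
          (fourierOpPi μ hψ hm * unipOpPi hl δ₂))))) := by simp only [mul_assoc]
    _ = unipOpPi hl γ₁ * (leviOpPi B₁ * ((fourierOpPi μ hψ hm * leviOpPi B₂) *
          (unipOpPi hl (Tₑ : (ι → F) →ₗ[F] (ι → F)) * (fourierOpPi μ hψ hm * unipOpPi hl δ₂)))) := by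
        rw [← unipOpPi_add, ← mul_assoc (unipOpPi hl (δ₁ + γ₂)) (leviOpPi B₂), unipOpPi_mul_leviOpPi, ← hT]
        simp only [mul_assoc]
    _ = unipOpPi hl γ₁ * (leviOpPi B₁ * (leviOpPi (dualLeviPi B₂) *
          ((fourierOpPi μ hψ hm * unipOpPi hl (Tₑ : (ι → F) →ₗ[F] (ι → F)) * fourierOpPi μ hψ hm) *
            unipOpPi hl δ₂))) := by
        rw [fourierOpPi_mul_leviOpPi]; simp only [mul_assoc]
    _ = unipOpPi hl γ₁ * (leviOpPi B₁ * (leviOpPi (dualLeviPi B₂) * (z *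
          (unipOpPi hl (-(Tₑ.symm : (ι → F) →ₗ[F] (ι → F))) * (leviOpPi Tₑ * (fourierOpPi μ hψ hm *
            (unipOpPi hl (-(Tₑ.symm : (ι → F) →ₗ[F] (ι → F))) * unipOpPi hl δ₂))))))) := by
        rw [h4]; simp only [mul_assoc]
    _ = z * (unipOpPi hl γ₁ * ((leviOpPi B₁ * leviOpPi (dualLeviPi B₂)) *
          (unipOpPi hl (-(Tₑ.symm : (ι → F) →ₗ[F] (ι → F))) * (leviOpPi Tₑ * (fourierOpPi μ hψ hm *
            (unipOpPi hl (-(Tₑ.symm : (ι → F) →ₗ[F] (ι → F))) * unipOpPi hl δ₂)))))) := by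
        rw [← mul_assoc (leviOpPi (dualLeviPi B₂)) z, commz, mul_assoc z, ← mul_assoc (leviOpPi B₁) z,
          commz, mul_assoc z, ← mul_assoc (unipOpPi hl γ₁) z, commz, mul_assoc z]
        simp only [mul_assoc]
    _ = z * (unipOpPi hl (γ₁ + (((dualLeviPi (B₁ * dualLeviPi B₂) : (ι → F) ≃ₗ[F] (ι → F)) :
            (ι → F) →ₗ[F] (ι → F)) ∘ₗ (-(Tₑ.symm : (ι → F) →ₗ[F] (ι → F))) ∘ₗ
            (((B₁ * dualLeviPi B₂).symm : (ι → F) ≃ₗ[F] (ι → F)) : (ι → F) →ₗ[F] (ι → F)))) *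
          leviOpPi (B₁ * dualLeviPi B₂ * Tₑ) * fourierOpPi μ hψ hm *
          unipOpPi hl (-(Tₑ.symm : (ι → F) →ₗ[F] (ι → F)) + δ₂)) := by
        rw [← leviOpPi_mul, ← mul_assoc (leviOpPi (B₁ * dualLeviPi B₂)) (unipOpPi hl _), leviOpPi_mul_unipOpPi,
          mul_assoc (unipOpPi hl _) (leviOpPi (B₁ * dualLeviPi B₂)), ← mul_assoc (unipOpPi hl γ₁) (unipOpPi hl _),
          ← unipOpPi_add, ← mul_assoc (leviOpPi (B₁ * dualLeviPi B₂)) (leviOpPi Tₑ), ← leviOpPi_mul,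
          ← unipOpPi_add]
        simp only [mul_assoc]

end Ops

end Literature.RepresentationTheory.HeisenbergGroup
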